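import Literature.Topology.FourManifolds.LatticeFormsSpecialOrthogonalHyperbolicSumPerfect
import HarnessLib

/-!
# `SO⁺(L)` is perfect and the characters of `SO⁺(L)`, `O⁺(L)`, `O(L)` for EVERY lattice `L ≅ U^{⊕n}`, `n ≥ 3` — in particular
# for every even unimodular lattice of signature `(n, n)` (the genus `II_{n,n}`)
# (Gritsenko–Hulek–Sankaran, *J. Algebra* 322 (2009), Prop. 1.6, Thm. 1.7, Cor. 1.8; Markman, *JEMS* (2023) §5.1 for `V ≅ U^{⊕4}`)

Trunk T-4MAN vocabulary. Row g50-#2 proved, in the standard model `hyperbolicSum n` (`n ≥ 3`): `SO⁺` is perfect,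
`[SO⁺, SO⁺] = [O⁺, O⁺] = SO⁺`, the cosets of `SO⁺` in `O` are cut out by `(χ, det)`, and Cor. 1.8 (characters). This file
makes those statements MODEL-FREE — for any lattice `(W′, B′)` with an isometry `e : U^{⊕n} ⥲ (W′, B′)` — by transporting
commutator words with constrained entries along `e` (`e⁻¹[α,β]e = [e⁻¹αe, e⁻¹βe]`, and `O⁺`, `det` are conjugation-invariant),
and then HYPOTHESIS-STYLE for every even unimodular lattice of rank `2n` and signature `0` (`≅ U^{⊕n}`, Huybrechts Ch. 14
Cor. 1.3 (i)). The first customer is Markman's `V = H¹(X,ℤ) ⊕ H¹(X,ℤ)* ≅ U^{⊕4}` (generalized Kummers): "the character group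
`Hom(O(V), ℂ*)` of `O(V)` is isomorphic to `ℤ/2ℤ × ℤ/2ℤ` and is generated by `det` and `ort`". Written for lane `lit-hodgefound`
(Track 2 foundations; prover seat `lit-hodgefound-p18`, gen 50, row g50-#3). THEOREMS ONLY — no definition, no named fact, no
instance, no notation.

## Sources, verbatim

* GHS 2009 (held `paper:arxiv-0810.1614`) p. 4: "**Proposition 1.6** Let `L = 2U ⊕ L₁` be an even unimodular lattice of rank
  at least `6`. Then `S̃O⁺(L)^{ab}` is trivial and `Õ⁺(L)^{ab} ≅ ℤ/2ℤ`." "**Theorem 1.7** […] `S̃O⁺(L)^{ab}` is trivial and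
  `Õ⁺(L)^{ab} ≅ ℤ/2ℤ`." "**Corollary 1.8** […] `Õ⁺(L)` has only one non-trivial character, namely `det`, and `S̃O⁺(L)` has no
  non-trivial characters."
* Markman 2023 (held `paper:arxiv-1805.11574`) §5.1, p. 14: "The character group `Hom(O(V), ℂ*)` of `O(V)` is isomorphic to
  `ℤ/2ℤ × ℤ/2ℤ` and is generated by the determinant character `det` and the orientation character `ort : O(V) → {±1}`. […]
  Denote by `O₊(V)` the kernel of `ort`." (proof: "The lattice `V` is the orthogonal direct sum of four copies of […] `U`.")
* Huybrechts, *Lectures on K3 surfaces*, Ch. 14 Cor. 1.3 (i) (indefinite even unimodular lattices are classified by rank and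
  signature; signature `0`, rank `2n` ⟹ `≅ U^{⊕n}`).

## Contents (all proved); `[α,β] = ((β⁻¹·α⁻¹)·β)·α` in `IsometryEquiv.trans` order; "`α ∈ SO⁺`" = `α ∈ O⁺ ∧ det α = 1`

* §1 transport: commutator words with entries constrained by `P` go, under `γ ↦ e⁻¹γe`, to commutator words with entries
  constrained by `P′` whenever `P α ⟹ P′(e⁻¹αe)` (`IsWordIn.commutators_conj_of`); `det(e⁻¹αe) = det α`.
* §2 generic consequences (any symmetric non-degenerate lattice) of "`SO⁺ ⊆ ⟨[SO⁺, SO⁺]⟩`": characters of `SO⁺` are trivial,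
  characters of `O⁺` factor through `det`, characters of `O` factor through `(χ, det)` and are `2`-torsion.
* §3 every `L ≅ U^{⊕n}`, `n ≥ 3`: `[SO⁺(L), SO⁺(L)] = SO⁺(L)` (`isWordIn_commutators_of_specialOrthogonal_iff_of_isometryEquiv_hyperbolicSum`),
  `[O⁺(L), O⁺(L)] = SO⁺(L)`, the coset criterion `φρ⁻¹ ∈ [O,O] ⟺ (χ, det) agree`, all four values of `(χ, det)` occur, and the
  four character statements.
* §4 the genus `II_{n,n}`, `n ≥ 3`, hypothesis-style: the same for every even unimodular `B` of rank `2n` and signature `0`.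
-/

noncomputable section

open Module
open LinearMap (BilinForm)
open LinearMap.BilinForm
open LinearMap.BilinForm (IsometryEquiv)

namespace Literature.Topology.FourManifolds

universe u

/-! ### §1 Transport of constrained commutator words along an isometry -/

section Transport

variable {W W' : Type*} [AddCommGroup W] [AddCommGroup W'] {B : BilinForm ℤ W} {B' : BilinForm ℤ W'}

/-- **`e⁻¹[α,β]e = [e⁻¹αe, e⁻¹βe]` for constrained commutator words**: if `φ` is a word in commutators `[α,β]` with `P α`, `P β`
and `P α ⟹ P′(e⁻¹αe)` along an isometry `e : (W,B) ⥲ (W′,B′)`, then `e⁻¹φe` is a word in commutators `[α′,β′]` with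
`P′ α′`, `P′ β′`. [cite: GritsenkoHulekSankaran2009, §3.1 (t4) and Cor. 1.8] -/
theorem IsWordIn.commutators_conj_of {P : B.IsometryEquiv B → Prop} {P' : B'.IsometryEquiv B' → Prop}
    (e : B.IsometryEquiv B') (hP : ∀ α, P α → P' (e.symm.trans (α.trans e))) {φ : B.IsometryEquiv B}
    (hφ : IsWordIn {ψ : B.IsometryEquiv B | ∃ α β : B.IsometryEquiv B,
      P α ∧ P β ∧ ψ = ((β.symm.trans α.symm).trans β).trans α} φ) :
    IsWordIn {ψ' : B'.IsometryEquiv B' | ∃ α β : B'.IsometryEquiv B',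
      P' α ∧ P' β ∧ ψ' = ((β.symm.trans α.symm).trans β).trans α} (e.symm.trans (φ.trans e)) := by
  refine (hφ.conj e).bind fun s hs ↦ ?_
  obtain ⟨ψ, ⟨α, β, hα, hβ, rfl⟩, rfl⟩ := hs
  refine IsWordIn.congr (IsWordIn.of_mem (φ := (((e.symm.trans (β.trans e)).symm.trans (e.symm.trans (α.trans e)).symm).trans
      (e.symm.trans (β.trans e))).trans (e.symm.trans (α.trans e)))
    ⟨e.symm.trans (α.trans e), e.symm.trans (β.trans e), hP α hα, hP β hβ, rfl⟩) fun v ↦ ?_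
  have hα' : ∀ w, (e.symm.trans (α.trans e)).symm w = e (α.symm (e.symm w)) := fun _ ↦ rfl
  have hβ' : ∀ w, (e.symm.trans (β.trans e)).symm w = e (β.symm (e.symm w)) := fun _ ↦ rfl
  simp only [LinearMap.BilinForm.IsometryEquiv.trans_apply, hα', hβ', LinearMap.BilinForm.IsometryEquiv.symm_apply_apply]

/-- `det(e⁻¹αe) = det α` along an isometry `e : (W,B) ⥲ (W′,B′)`. [cite: GritsenkoHulekSankaran2009, Cor. 1.8 ("det" is a character)] -/
theorem IsometryEquiv.det_symm_trans_trans (e : B.IsometryEquiv B') (α : B.IsometryEquiv B) :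
    LinearMap.det ((e.symm.trans (α.trans e) : B'.IsometryEquiv B') : W' →ₗ[ℤ] W') = LinearMap.det (α : W →ₗ[ℤ] W) := by
  rw [show ((e.symm.trans (α.trans e) : B'.IsometryEquiv B') : W' →ₗ[ℤ] W') =
      ((e.toLinearEquiv : W ≃ₗ[ℤ] W') : W →ₗ[ℤ] W') ∘ₗ (α : W →ₗ[ℤ] W) ∘ₗ ((e.toLinearEquiv.symm : W' ≃ₗ[ℤ] W) : W' →ₗ[ℤ] W)
      from LinearMap.ext fun _ ↦ rfl, LinearMap.det_conj]

end Transport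

/-! ### §2 Generic consequences of "`SO⁺(L) ⊆ ⟨[SO⁺(L), SO⁺(L)]⟩`" for characters -/

section Generic

variable {L : Type u} [AddCommGroup L] [Module.Finite ℤ L] [Module.Free ℤ L] {Q : BilinForm ℤ L} {A : Type*} [CommGroup A]
  {f : Q.IsometryEquiv Q → A}

/-- **A perfect `SO⁺(L)` has no non-trivial characters**: if every element of `SO⁺(L)` is a word in commutators of elements of
`SO⁺(L)`, every map to an abelian group multiplicative on `SO⁺(L)` is `1` there. [cite: GritsenkoHulekSankaran2009, Cor. 1.8] -/
theorem character_eq_one_of_specialOrthogonal_of_forall_isWordIn (hQ : Q.IsSymm) (hnd : Q.Nondegenerate)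
    (H : ∀ φ : Q.IsometryEquiv Q, φ.IsOrientationPreserving ∧ LinearMap.det (φ : L →ₗ[ℤ] L) = 1 →
      IsWordIn {ψ | ∃ α β : Q.IsometryEquiv Q, (α.IsOrientationPreserving ∧ LinearMap.det (α : L →ₗ[ℤ] L) = 1) ∧
        (β.IsOrientationPreserving ∧ LinearMap.det (β : L →ₗ[ℤ] L) = 1) ∧ ψ = ((β.symm.trans α.symm).trans β).trans α} φ)
    (hf : ∀ α β : Q.IsometryEquiv Q, (α.IsOrientationPreserving ∧ LinearMap.det (α : L →ₗ[ℤ] L) = 1) →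
      (β.IsOrientationPreserving ∧ LinearMap.det (β : L →ₗ[ℤ] L) = 1) → f (α.trans β) = f α * f β)
    (φ : Q.IsometryEquiv Q) (hφ : φ.IsOrientationPreserving ∧ LinearMap.det (φ : L →ₗ[ℤ] L) = 1) : f φ = 1 :=
  (IsWordIn.map_eq_one_of_commutators_of_map_trans
    (G := fun α : Q.IsometryEquiv Q ↦ α.IsOrientationPreserving ∧ LinearMap.det (α : L →ₗ[ℤ] L) = 1)
    specialOrthogonal_refl (specialOrthogonal_trans hQ hnd) (specialOrthogonal_symm hQ hnd) hf (fun _ hs ↦ hs) (H φ hφ)).2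

/-- **Characters of `O⁺(L)` factor through `det` when `SO⁺(L)` is perfect**: a map to an abelian group multiplicative on
`O⁺(L)` agrees on `φ, ψ ∈ O⁺(L)` with `det φ = det ψ`. [cite: GritsenkoHulekSankaran2009, Cor. 1.8 ("only one non-trivial character, namely det")] -/
theorem character_eq_of_isOrientationPreserving_of_det_eq_of_forall_isWordIn (hQ : Q.IsSymm) (hnd : Q.Nondegenerate)
    (H : ∀ φ : Q.IsometryEquiv Q, φ.IsOrientationPreserving ∧ LinearMap.det (φ : L →ₗ[ℤ] L) = 1 →
      IsWordIn {ψ | ∃ α β : Q.IsometryEquiv Q, (α.IsOrientationPreserving ∧ LinearMap.det (α : L →ₗ[ℤ] L) = 1) ∧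
        (β.IsOrientationPreserving ∧ LinearMap.det (β : L →ₗ[ℤ] L) = 1) ∧ ψ = ((β.symm.trans α.symm).trans β).trans α} φ)
    (hf : ∀ α β : Q.IsometryEquiv Q, α.IsOrientationPreserving → β.IsOrientationPreserving → f (α.trans β) = f α * f β)
    (φ ψ : Q.IsometryEquiv Q) (hφ : φ.IsOrientationPreserving) (hψ : ψ.IsOrientationPreserving)
    (hdet : LinearMap.det (φ : L →ₗ[ℤ] L) = LinearMap.det (ψ : L →ₗ[ℤ] L)) : f φ = f ψ := by
  have hψ' : ψ.symm.IsOrientationPreserving := (LinearMap.BilinForm.IsometryEquiv.isOrientationPreserving_symm_iff hQ hnd ψ).2 hψ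
  have h1 : f (φ.trans ψ.symm) = 1 := by
    refine character_eq_one_of_specialOrthogonal_of_forall_isWordIn hQ hnd H (fun α β hα hβ ↦ hf α β hα.1 hβ.1) _ ⟨?_, ?_⟩
    · exact (LinearMap.BilinForm.IsometryEquiv.isOrientationPreserving_trans_iff hQ hnd φ ψ.symm).2 (iff_of_true hψ' hφ)
    · rw [IsometryEquiv.det_trans_eq_mul, IsometryEquiv.det_symm_eq, hdet]
      rcases LinearMap.BilinForm.IsometryEquiv.det_eq_one_or_eq_neg_one ψ with h | h <;> rw [h] <;> norm_num
  rw [hf φ ψ.symm hφ hψ', map_symm_eq_inv_of_map_trans (G := fun α : Q.IsometryEquiv Q ↦ α.IsOrientationPreserving)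
    LinearMap.BilinForm.IsometryEquiv.IsOrientationPreserving.refl
    (fun α hα ↦ (LinearMap.BilinForm.IsometryEquiv.isOrientationPreserving_symm_iff hQ hnd α).2 hα) hf hψ] at h1
  exact mul_inv_eq_one.1 h1

/-- **Characters of `O(L)` factor through `(χ, det)` when `SO⁺(L)` is perfect**: a multiplicative map to an abelian group agrees
on `φ, ψ` with `χ(φ) = χ(ψ)` and `det φ = det ψ`. [cite: GritsenkoHulekSankaran2009, Cor. 1.8] [cite: Markman2023GeneralizedKummers, §5.1 ("Hom(O(V), ℂ*) … generated by det and ort")] -/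
theorem character_eq_of_det_eq_of_forall_isWordIn (hQ : Q.IsSymm) (hnd : Q.Nondegenerate)
    (H : ∀ φ : Q.IsometryEquiv Q, φ.IsOrientationPreserving ∧ LinearMap.det (φ : L →ₗ[ℤ] L) = 1 →
      IsWordIn {ψ | ∃ α β : Q.IsometryEquiv Q, (α.IsOrientationPreserving ∧ LinearMap.det (α : L →ₗ[ℤ] L) = 1) ∧
        (β.IsOrientationPreserving ∧ LinearMap.det (β : L →ₗ[ℤ] L) = 1) ∧ ψ = ((β.symm.trans α.symm).trans β).trans α} φ)
    (hf : ∀ α β : Q.IsometryEquiv Q, f (α.trans β) = f α * f β) (φ ψ : Q.IsometryEquiv Q)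
    (hχ : φ.IsOrientationPreserving ↔ ψ.IsOrientationPreserving)
    (hdet : LinearMap.det (φ : L →ₗ[ℤ] L) = LinearMap.det (ψ : L →ₗ[ℤ] L)) : f φ = f ψ := by
  have h1 : f (φ.trans ψ.symm) = 1 := by
    refine character_eq_one_of_specialOrthogonal_of_forall_isWordIn hQ hnd H (fun α β _ _ ↦ hf α β) _ ⟨?_, ?_⟩
    · rw [LinearMap.BilinForm.IsometryEquiv.isOrientationPreserving_trans_iff hQ hnd,
        LinearMap.BilinForm.IsometryEquiv.isOrientationPreserving_symm_iff hQ hnd]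
      exact hχ.symm
    · rw [IsometryEquiv.det_trans_eq_mul, IsometryEquiv.det_symm_eq, hdet]
      rcases LinearMap.BilinForm.IsometryEquiv.det_eq_one_or_eq_neg_one ψ with h | h <;> rw [h] <;> norm_num
  rw [hf, map_symm_eq_inv_of_map_trans (G := fun _ : Q.IsometryEquiv Q ↦ True) trivial (fun _ _ ↦ trivial)
    (fun α β _ _ ↦ hf α β) trivial] at h1
  exact mul_inv_eq_one.1 h1

/-- **`O(L)^{ab}` is `2`-torsion when `SO⁺(L)` is perfect**: `f(φ)² = 1` for every multiplicative map to an abelian group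
(`φ² ∈ SO⁺(L)`). [cite: GritsenkoHulekSankaran2009, Cor. 1.8] [cite: Markman2023GeneralizedKummers, §5.1] -/
theorem character_mul_self_of_forall_isWordIn (hQ : Q.IsSymm) (hnd : Q.Nondegenerate)
    (H : ∀ φ : Q.IsometryEquiv Q, φ.IsOrientationPreserving ∧ LinearMap.det (φ : L →ₗ[ℤ] L) = 1 →
      IsWordIn {ψ | ∃ α β : Q.IsometryEquiv Q, (α.IsOrientationPreserving ∧ LinearMap.det (α : L →ₗ[ℤ] L) = 1) ∧
        (β.IsOrientationPreserving ∧ LinearMap.det (β : L →ₗ[ℤ] L) = 1) ∧ ψ = ((β.symm.trans α.symm).trans β).trans α} φ)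
    (hf : ∀ α β : Q.IsometryEquiv Q, f (α.trans β) = f α * f β) (φ : Q.IsometryEquiv Q) : f φ * f φ = 1 := by
  rw [← hf]
  refine character_eq_one_of_specialOrthogonal_of_forall_isWordIn hQ hnd H (fun α β _ _ ↦ hf α β) _ ⟨?_, ?_⟩
  · exact (LinearMap.BilinForm.IsometryEquiv.isOrientationPreserving_trans_iff hQ hnd φ φ).2 Iff.rfl
  · rw [IsometryEquiv.det_trans_eq_mul]
    rcases LinearMap.BilinForm.IsometryEquiv.det_eq_one_or_eq_neg_one φ with h | h <;> rw [h] <;> norm_num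

end Generic

/-! ### §3 Every lattice isometric to `U^{⊕n}`, `n ≥ 3` -/

section Model

variable {W' : Type} [AddCommGroup W'] [Module.Finite ℤ W'] [Module.Free ℤ W'] {B' : BilinForm ℤ W'}

/-- **`SO⁺(L)` is perfect for every `L ≅ U^{⊕n}`, `n ≥ 3`** (Thm. 1.7 (i), Prop. 1.6: "`S̃O⁺(L)^{ab}` is trivial"): an isometry of
`(W′,B′) ≅ U^{⊕n}` is a word in the commutators `[α,β]`, `α, β ∈ SO⁺(B′)`, iff it lies in `SO⁺(B′)`.
[cite: GritsenkoHulekSankaran2009, Thm. 1.7, Prop. 1.6 and Cor. 1.8] -/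
theorem isWordIn_commutators_of_specialOrthogonal_iff_of_isometryEquiv_hyperbolicSum {n : ℕ} (hn : 3 ≤ n) (hB' : B'.IsSymm)
    (hnd' : B'.Nondegenerate) (e : (hyperbolicSum n).IsometryEquiv B') (φ' : B'.IsometryEquiv B') :
    IsWordIn {ψ' | ∃ α β : B'.IsometryEquiv B', (α.IsOrientationPreserving ∧ LinearMap.det (α : W' →ₗ[ℤ] W') = 1) ∧
        (β.IsOrientationPreserving ∧ LinearMap.det (β : W' →ₗ[ℤ] W') = 1) ∧ ψ' = ((β.symm.trans α.symm).trans β).trans α} φ' ↔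
      φ'.IsOrientationPreserving ∧ LinearMap.det (φ' : W' →ₗ[ℤ] W') = 1 := by
  refine ⟨fun h ↦ IsWordIn.isOrientationPreserving_and_det_eq_one_of_commutators hB' hnd'
    (fun s hs ↦ by obtain ⟨α, β, -, -, hs⟩ := hs; exact ⟨α, β, hs⟩) h, fun h ↦ ?_⟩
  have hφ₁ : (e.trans (φ'.trans e.symm)).IsOrientationPreserving :=
    (LinearMap.BilinForm.IsometryEquiv.isOrientationPreserving_trans_trans_symm_iff e φ').2 h.1
  have hφ₂ : LinearMap.det ((e.trans (φ'.trans e.symm) : (hyperbolicSum n).IsometryEquiv _) :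
      (Fin n → ℤ) × (Fin n → ℤ) →ₗ[ℤ] (Fin n → ℤ) × (Fin n → ℤ)) = 1 := by
    rw [IsometryEquiv.det_trans_trans_symm, h.2]
  have hw := (hyperbolicSum_isWordIn_commutators_of_specialOrthogonal_iff hn _).2 ⟨hφ₁, hφ₂⟩
  refine (hw.commutators_conj_of (P' := fun α : B'.IsometryEquiv B' ↦ α.IsOrientationPreserving ∧
      LinearMap.det (α : W' →ₗ[ℤ] W') = 1) e fun α hα ↦ ⟨?_, ?_⟩).congr fun v ↦
    IsometryEquiv.symm_trans_trans_trans_symm_trans_apply e φ' v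
  · exact (LinearMap.BilinForm.IsometryEquiv.isOrientationPreserving_symm_trans_trans_iff e α).2 hα.1
  · rw [IsometryEquiv.det_symm_trans_trans, hα.2]

/-- **`[O⁺(L), O⁺(L)] = SO⁺(L)` for every `L ≅ U^{⊕n}`, `n ≥ 3`**: an isometry of `(W′,B′) ≅ U^{⊕n}` is a word in the commutators
`[α,β]`, `α, β ∈ O⁺(B′)`, iff it lies in `SO⁺(B′)` (so `O⁺(L)^{ab} = O⁺/SO⁺ ≅ ℤ/2ℤ`, Thm. 1.7 (ii)).
[cite: GritsenkoHulekSankaran2009, Thm. 1.7 and Cor. 1.8] -/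
theorem isWordIn_commutators_of_isOrientationPreserving_iff_of_isometryEquiv_hyperbolicSum {n : ℕ} (hn : 3 ≤ n)
    (hB' : B'.IsSymm) (hnd' : B'.Nondegenerate) (e : (hyperbolicSum n).IsometryEquiv B') (φ' : B'.IsometryEquiv B') :
    IsWordIn {ψ' | ∃ α β : B'.IsometryEquiv B', α.IsOrientationPreserving ∧ β.IsOrientationPreserving ∧
        ψ' = ((β.symm.trans α.symm).trans β).trans α} φ' ↔
      φ'.IsOrientationPreserving ∧ LinearMap.det (φ' : W' →ₗ[ℤ] W') = 1 := by
  refine ⟨fun h ↦ IsWordIn.isOrientationPreserving_and_det_eq_one_of_commutators hB' hnd'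
    (fun s hs ↦ by obtain ⟨α, β, -, -, hs⟩ := hs; exact ⟨α, β, hs⟩) h, fun h ↦ ?_⟩
  refine ((isWordIn_commutators_of_specialOrthogonal_iff_of_isometryEquiv_hyperbolicSum hn hB' hnd' e φ').2 h).mono
    fun s hs ↦ ?_
  obtain ⟨α, β, hα, hβ, hs⟩ := hs
  exact ⟨α, β, hα.1, hβ.1, hs⟩

/-- **The cosets of `SO⁺(L) = [O(L), O(L)]` in `O(L)` for `L ≅ U^{⊕n}`, `n ≥ 3`, are cut out by `(χ, det)`**: `φρ⁻¹` is a word in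
commutators iff `φ, ρ` are both or neither in `O⁺` and `det φ = det ρ`.
[cite: GritsenkoHulekSankaran2009, Cor. 1.8 and p. 4] [cite: Markman2023GeneralizedKummers, §5.1 ("Hom(O(V), ℂ*) ≅ ℤ/2ℤ × ℤ/2ℤ")] -/
theorem isWordIn_commutators_trans_symm_iff_of_isometryEquiv_hyperbolicSum {n : ℕ} (hn : 3 ≤ n) (hB' : B'.IsSymm)
    (hnd' : B'.Nondegenerate) (e : (hyperbolicSum n).IsometryEquiv B') (φ' ρ' : B'.IsometryEquiv B') :
    IsWordIn {ψ' | ∃ α β : B'.IsometryEquiv B', ψ' = ((β.symm.trans α.symm).trans β).trans α} (φ'.trans ρ'.symm) ↔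
      (φ'.IsOrientationPreserving ↔ ρ'.IsOrientationPreserving) ∧
        LinearMap.det (φ' : W' →ₗ[ℤ] W') = LinearMap.det (ρ' : W' →ₗ[ℤ] W') := by
  rw [isWordIn_commutators_iff_of_isometryEquiv_hyperbolicSum hn hB' hnd' e,
    LinearMap.BilinForm.IsometryEquiv.isOrientationPreserving_trans_iff hB' hnd',
    LinearMap.BilinForm.IsometryEquiv.isOrientationPreserving_symm_iff hB' hnd', IsometryEquiv.det_trans_eq_mul,
    IsometryEquiv.det_symm_eq]
  rcases LinearMap.BilinForm.IsometryEquiv.det_eq_one_or_eq_neg_one ρ' with hρ | hρ <;>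
    rcases LinearMap.BilinForm.IsometryEquiv.det_eq_one_or_eq_neg_one φ' with hφ | hφ <;>
    simp [hρ, hφ, iff_comm]

/-- **All four values of `(χ, det)` occur in `O(L)`, `L ≅ U^{⊕n}`, `n ≥ 1`** (so `O(L)/SO⁺(L) ≅ {±1}²`, and on `O⁺(L)` the
character `det` is non-trivial): `L` has a `(−2)`-reflection (`χ = 1`, `det = −1`), a `(+2)`-reflection (`χ = −1`, `det = −1`),
and their product (`χ = −1`, `det = 1`). [cite: GritsenkoHulekSankaran2009, §1 and §4 ("Õ⁺(L) = ⟨S̃O⁺(L), σ_{e−f}⟩")] [cite: Markman2023GeneralizedKummers, §5.1] -/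
theorem exists_isometryEquiv_invariants_of_isometryEquiv_hyperbolicSum {n : ℕ} (hn : 1 ≤ n) (hB' : B'.IsSymm)
    (hnd' : B'.Nondegenerate) (e : (hyperbolicSum n).IsometryEquiv B') :
    (∃ σ : B'.IsometryEquiv B', σ.IsOrientationPreserving ∧ LinearMap.det (σ : W' →ₗ[ℤ] W') = -1) ∧
    (∃ τ : B'.IsometryEquiv B', ¬ τ.IsOrientationPreserving ∧ LinearMap.det (τ : W' →ₗ[ℤ] W') = -1) ∧
    (∃ υ : B'.IsometryEquiv B', ¬ υ.IsOrientationPreserving ∧ LinearMap.det (υ : W' →ₗ[ℤ] W') = 1) := by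
  set j : Fin n := ⟨0, by omega⟩ with hj
  have hm : B' (e (Pi.single j 1, -Pi.single j 1)) (e (Pi.single j 1, -Pi.single j 1)) = -1 + -1 := by
    rw [e.map_app, hyperbolicSum_single_neg_single]
  have hp : B' (e (Pi.single j 1, Pi.single j 1)) (e (Pi.single j 1, Pi.single j 1)) = 1 + 1 := by
    rw [e.map_app, hyperbolicSum_single_single]
  have hσ : (normTwoReflectionEquiv hB' _ (-1) hm (by norm_num)).IsOrientationPreserving := by
    rw [isOrientationPreserving_normTwoReflectionEquiv_iff _ hB' hnd']
  have hτ : ¬ (normTwoReflectionEquiv hB' _ 1 hp (by norm_num)).IsOrientationPreserving := by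
    rw [isOrientationPreserving_normTwoReflectionEquiv_iff _ hB' hnd']
    norm_num
  refine ⟨⟨_, hσ, det_normTwoReflectionEquiv _ hB' _ _ hm _⟩, ⟨_, hτ, det_normTwoReflectionEquiv _ hB' _ _ hp _⟩,
    ⟨(normTwoReflectionEquiv hB' _ (-1) hm (by norm_num)).trans (normTwoReflectionEquiv hB' _ 1 hp (by norm_num)), ?_, ?_⟩⟩
  · rw [LinearMap.BilinForm.IsometryEquiv.isOrientationPreserving_trans_iff hB' hnd']
    exact fun h ↦ hτ (h.2 hσ)
  · rw [IsometryEquiv.det_trans_eq_mul, det_normTwoReflectionEquiv _ hB', det_normTwoReflectionEquiv _ hB']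
    norm_num

variable {A : Type*} [CommGroup A] {f : B'.IsometryEquiv B' → A}

/-- **Cor. 1.8 for every `L ≅ U^{⊕n}`, `n ≥ 3`: `SO⁺(L)` has no non-trivial characters.**
[cite: GritsenkoHulekSankaran2009, Cor. 1.8 and Prop. 1.6] -/
theorem character_eq_one_of_specialOrthogonal_of_isometryEquiv_hyperbolicSum {n : ℕ} (hn : 3 ≤ n) (hB' : B'.IsSymm)
    (hnd' : B'.Nondegenerate) (e : (hyperbolicSum n).IsometryEquiv B')
    (hf : ∀ α β : B'.IsometryEquiv B', (α.IsOrientationPreserving ∧ LinearMap.det (α : W' →ₗ[ℤ] W') = 1) →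
      (β.IsOrientationPreserving ∧ LinearMap.det (β : W' →ₗ[ℤ] W') = 1) → f (α.trans β) = f α * f β)
    (φ' : B'.IsometryEquiv B') (hφ' : φ'.IsOrientationPreserving ∧ LinearMap.det (φ' : W' →ₗ[ℤ] W') = 1) : f φ' = 1 :=
  character_eq_one_of_specialOrthogonal_of_forall_isWordIn hB' hnd'
    (fun ψ hψ ↦ (isWordIn_commutators_of_specialOrthogonal_iff_of_isometryEquiv_hyperbolicSum hn hB' hnd' e ψ).2 hψ) hf φ' hφ'

/-- **Cor. 1.8 for every `L ≅ U^{⊕n}`, `n ≥ 3`: every character of `O⁺(L)` factors through `det`** ("only one non-trivial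
character, namely `det`"). [cite: GritsenkoHulekSankaran2009, Cor. 1.8 and Prop. 1.6] -/
theorem character_eq_of_isOrientationPreserving_of_det_eq_of_isometryEquiv_hyperbolicSum {n : ℕ} (hn : 3 ≤ n)
    (hB' : B'.IsSymm) (hnd' : B'.Nondegenerate) (e : (hyperbolicSum n).IsometryEquiv B')
    (hf : ∀ α β : B'.IsometryEquiv B', α.IsOrientationPreserving → β.IsOrientationPreserving → f (α.trans β) = f α * f β)
    (φ' ψ' : B'.IsometryEquiv B') (hφ' : φ'.IsOrientationPreserving) (hψ' : ψ'.IsOrientationPreserving)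
    (hdet : LinearMap.det (φ' : W' →ₗ[ℤ] W') = LinearMap.det (ψ' : W' →ₗ[ℤ] W')) : f φ' = f ψ' :=
  character_eq_of_isOrientationPreserving_of_det_eq_of_forall_isWordIn hB' hnd'
    (fun ψ hψ ↦ (isWordIn_commutators_of_specialOrthogonal_iff_of_isometryEquiv_hyperbolicSum hn hB' hnd' e ψ).2 hψ) hf φ' ψ'
    hφ' hψ' hdet

/-- **Characters of `O(L)` factor through `(χ, det)` for every `L ≅ U^{⊕n}`, `n ≥ 3`** — with
`exists_isometryEquiv_invariants_of_isometryEquiv_hyperbolicSum` this is "`Hom(O(V), ℂ*) ≅ ℤ/2ℤ × ℤ/2ℤ`, generated by `det` and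
`ort`" (Markman, `V ≅ U^{⊕4}`). [cite: Markman2023GeneralizedKummers, §5.1] [cite: GritsenkoHulekSankaran2009, Cor. 1.8] -/
theorem character_eq_of_det_eq_of_isometryEquiv_hyperbolicSum {n : ℕ} (hn : 3 ≤ n) (hB' : B'.IsSymm) (hnd' : B'.Nondegenerate)
    (e : (hyperbolicSum n).IsometryEquiv B') (hf : ∀ α β : B'.IsometryEquiv B', f (α.trans β) = f α * f β)
    (φ' ψ' : B'.IsometryEquiv B') (hχ : φ'.IsOrientationPreserving ↔ ψ'.IsOrientationPreserving)
    (hdet : LinearMap.det (φ' : W' →ₗ[ℤ] W') = LinearMap.det (ψ' : W' →ₗ[ℤ] W')) : f φ' = f ψ' :=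
  character_eq_of_det_eq_of_forall_isWordIn hB' hnd'
    (fun ψ hψ ↦ (isWordIn_commutators_of_specialOrthogonal_iff_of_isometryEquiv_hyperbolicSum hn hB' hnd' e ψ).2 hψ) hf φ' ψ'
    hχ hdet

/-- **`O(L)^{ab}` is `2`-torsion for every `L ≅ U^{⊕n}`, `n ≥ 3`**: `f(φ)² = 1` for every multiplicative map to an abelian group.
[cite: Markman2023GeneralizedKummers, §5.1] [cite: GritsenkoHulekSankaran2009, Cor. 1.8] -/
theorem character_mul_self_of_isometryEquiv_hyperbolicSum {n : ℕ} (hn : 3 ≤ n) (hB' : B'.IsSymm) (hnd' : B'.Nondegenerate)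
    (e : (hyperbolicSum n).IsometryEquiv B') (hf : ∀ α β : B'.IsometryEquiv B', f (α.trans β) = f α * f β)
    (φ' : B'.IsometryEquiv B') : f φ' * f φ' = 1 :=
  character_mul_self_of_forall_isWordIn hB' hnd'
    (fun ψ hψ ↦ (isWordIn_commutators_of_specialOrthogonal_iff_of_isometryEquiv_hyperbolicSum hn hB' hnd' e ψ).2 hψ) hf φ'

end Model

/-! ### §4 Every even unimodular lattice of signature `(n, n)`, `n ≥ 3` (the genus `II_{n,n}`) -/

section EvenUnimodular

variable {W : Type} [AddCommGroup W] [Module.Finite ℤ W] [Module.Free ℤ W] {B : BilinForm ℤ W}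

/-- **Prop. 1.6 / Thm. 1.7 (i) for `II_{n,n}`, `n ≥ 3`: `SO⁺` is perfect** — for every even unimodular lattice of rank `2n ≥ 6` and
signature `0`, an isometry is a word in the commutators of elements of `SO⁺` iff it lies in `SO⁺`.
[cite: GritsenkoHulekSankaran2009, Prop. 1.6 and Thm. 1.7] [cite: Huybrechts2016K3, Ch. 14 Cor. 1.3 (i)] -/
theorem isWordIn_commutators_of_specialOrthogonal_iff_of_isUnimodular_of_isEven (hB : B.IsSymm) (hU : B.IsUnimodular)
    (he : B.IsEven) {n : ℕ} (hn : 3 ≤ n) (hrank : finrank ℤ W = 2 * n) (hsig : B.signature = 0) (φ : B.IsometryEquiv B) :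
    IsWordIn {ψ | ∃ α β : B.IsometryEquiv B, (α.IsOrientationPreserving ∧ LinearMap.det (α : W →ₗ[ℤ] W) = 1) ∧
        (β.IsOrientationPreserving ∧ LinearMap.det (β : W →ₗ[ℤ] W) = 1) ∧ ψ = ((β.symm.trans α.symm).trans β).trans α} φ ↔
      φ.IsOrientationPreserving ∧ LinearMap.det (φ : W →ₗ[ℤ] W) = 1 := by
  obtain ⟨e⟩ := equivalent_hyperbolicSum_of_signature_eq_zero _ hB hU he (by omega) hrank hsig
  exact isWordIn_commutators_of_specialOrthogonal_iff_of_isometryEquiv_hyperbolicSum hn hB hU.nondegenerate e.symm φ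

/-- **Thm. 1.7 for `II_{n,n}`, `n ≥ 3`: `[O⁺, O⁺] = SO⁺`** (hence `O⁺^{ab} ≅ ℤ/2ℤ`).
[cite: GritsenkoHulekSankaran2009, Prop. 1.6 and Thm. 1.7] [cite: Huybrechts2016K3, Ch. 14 Cor. 1.3 (i)] -/
theorem isWordIn_commutators_of_isOrientationPreserving_iff_of_isUnimodular_of_isEven (hB : B.IsSymm) (hU : B.IsUnimodular)
    (he : B.IsEven) {n : ℕ} (hn : 3 ≤ n) (hrank : finrank ℤ W = 2 * n) (hsig : B.signature = 0) (φ : B.IsometryEquiv B) :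
    IsWordIn {ψ | ∃ α β : B.IsometryEquiv B, α.IsOrientationPreserving ∧ β.IsOrientationPreserving ∧
        ψ = ((β.symm.trans α.symm).trans β).trans α} φ ↔
      φ.IsOrientationPreserving ∧ LinearMap.det (φ : W →ₗ[ℤ] W) = 1 := by
  obtain ⟨e⟩ := equivalent_hyperbolicSum_of_signature_eq_zero _ hB hU he (by omega) hrank hsig
  exact isWordIn_commutators_of_isOrientationPreserving_iff_of_isometryEquiv_hyperbolicSum hn hB hU.nondegenerate e.symm φ

/-- **The cosets of `SO⁺ = [O, O]` in `O` for `II_{n,n}`, `n ≥ 3`, are cut out by `(χ, det)`.**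
[cite: GritsenkoHulekSankaran2009, Cor. 1.8 and p. 4] [cite: Huybrechts2016K3, Ch. 14 Cor. 1.3 (i)] -/
theorem isWordIn_commutators_trans_symm_iff_of_isUnimodular_of_isEven (hB : B.IsSymm) (hU : B.IsUnimodular) (he : B.IsEven)
    {n : ℕ} (hn : 3 ≤ n) (hrank : finrank ℤ W = 2 * n) (hsig : B.signature = 0) (φ ρ : B.IsometryEquiv B) :
    IsWordIn {ψ | ∃ α β : B.IsometryEquiv B, ψ = ((β.symm.trans α.symm).trans β).trans α} (φ.trans ρ.symm) ↔
      (φ.IsOrientationPreserving ↔ ρ.IsOrientationPreserving) ∧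
        LinearMap.det (φ : W →ₗ[ℤ] W) = LinearMap.det (ρ : W →ₗ[ℤ] W) := by
  obtain ⟨e⟩ := equivalent_hyperbolicSum_of_signature_eq_zero _ hB hU he (by omega) hrank hsig
  exact isWordIn_commutators_trans_symm_iff_of_isometryEquiv_hyperbolicSum hn hB hU.nondegenerate e.symm φ ρ

variable {A : Type*} [CommGroup A] {f : B.IsometryEquiv B → A}

/-- **Prop. 1.6 / Cor. 1.8 for `II_{n,n}`, `n ≥ 3`: `SO⁺` has no non-trivial characters.**
[cite: GritsenkoHulekSankaran2009, Prop. 1.6 and Cor. 1.8] [cite: Huybrechts2016K3, Ch. 14 Cor. 1.3 (i)] -/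
theorem character_eq_one_of_specialOrthogonal_of_isUnimodular_of_isEven (hB : B.IsSymm) (hU : B.IsUnimodular)
    (he : B.IsEven) {n : ℕ} (hn : 3 ≤ n) (hrank : finrank ℤ W = 2 * n) (hsig : B.signature = 0)
    (hf : ∀ α β : B.IsometryEquiv B, (α.IsOrientationPreserving ∧ LinearMap.det (α : W →ₗ[ℤ] W) = 1) →
      (β.IsOrientationPreserving ∧ LinearMap.det (β : W →ₗ[ℤ] W) = 1) → f (α.trans β) = f α * f β)
    (φ : B.IsometryEquiv B) (hφ : φ.IsOrientationPreserving ∧ LinearMap.det (φ : W →ₗ[ℤ] W) = 1) : f φ = 1 := by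
  obtain ⟨e⟩ := equivalent_hyperbolicSum_of_signature_eq_zero _ hB hU he (by omega) hrank hsig
  exact character_eq_one_of_specialOrthogonal_of_isometryEquiv_hyperbolicSum hn hB hU.nondegenerate e.symm hf φ hφ

/-- **Prop. 1.6 / Cor. 1.8 for `II_{n,n}`, `n ≥ 3`: every character of `O⁺` factors through `det`** (`Õ⁺^{ab} ≅ ℤ/2ℤ`).
[cite: GritsenkoHulekSankaran2009, Prop. 1.6 and Cor. 1.8] [cite: Huybrechts2016K3, Ch. 14 Cor. 1.3 (i)] -/
theorem character_eq_of_isOrientationPreserving_of_det_eq_of_isUnimodular_of_isEven (hB : B.IsSymm) (hU : B.IsUnimodular)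
    (he : B.IsEven) {n : ℕ} (hn : 3 ≤ n) (hrank : finrank ℤ W = 2 * n) (hsig : B.signature = 0)
    (hf : ∀ α β : B.IsometryEquiv B, α.IsOrientationPreserving → β.IsOrientationPreserving → f (α.trans β) = f α * f β)
    (φ ψ : B.IsometryEquiv B) (hφ : φ.IsOrientationPreserving) (hψ : ψ.IsOrientationPreserving)
    (hdet : LinearMap.det (φ : W →ₗ[ℤ] W) = LinearMap.det (ψ : W →ₗ[ℤ] W)) : f φ = f ψ := by
  obtain ⟨e⟩ := equivalent_hyperbolicSum_of_signature_eq_zero _ hB hU he (by omega) hrank hsig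
  exact character_eq_of_isOrientationPreserving_of_det_eq_of_isometryEquiv_hyperbolicSum hn hB hU.nondegenerate e.symm hf φ ψ
    hφ hψ hdet

/-- **Characters of `O` factor through `(χ, det)` and are `2`-torsion, for `II_{n,n}`, `n ≥ 3`** (`O^{ab} ≅ (ℤ/2ℤ)²`).
[cite: GritsenkoHulekSankaran2009, Cor. 1.8 and p. 4] [cite: Markman2023GeneralizedKummers, §5.1] [cite: Huybrechts2016K3, Ch. 14 Cor. 1.3 (i)] -/
theorem character_eq_of_det_eq_of_isUnimodular_of_isEven (hB : B.IsSymm) (hU : B.IsUnimodular) (he : B.IsEven) {n : ℕ}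
    (hn : 3 ≤ n) (hrank : finrank ℤ W = 2 * n) (hsig : B.signature = 0)
    (hf : ∀ α β : B.IsometryEquiv B, f (α.trans β) = f α * f β) (φ ψ : B.IsometryEquiv B)
    (hχ : φ.IsOrientationPreserving ↔ ψ.IsOrientationPreserving)
    (hdet : LinearMap.det (φ : W →ₗ[ℤ] W) = LinearMap.det (ψ : W →ₗ[ℤ] W)) : f φ = f ψ ∧ f φ * f φ = 1 := by
  obtain ⟨e⟩ := equivalent_hyperbolicSum_of_signature_eq_zero _ hB hU he (by omega) hrank hsig
  exact ⟨character_eq_of_det_eq_of_isometryEquiv_hyperbolicSum hn hB hU.nondegenerate e.symm hf φ ψ hχ hdet,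
    character_mul_self_of_isometryEquiv_hyperbolicSum hn hB hU.nondegenerate e.symm hf φ⟩

end EvenUnimodular

end Literature.Topology.FourManifolds

end
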